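import Mathlib
import HarnessLib
import Summits.HubbardSuperconductivity.HubbardSuperconductivity.Theorems.WeakCouplingBCSDefsKlThirdOrder
import Summits.HubbardSuperconductivity.HubbardSuperconductivity.Theorems.WeakCouplingBCSDefsKlU0Window

/-!
# Route `WeakCouplingBCS` — channel-margin lane of `WcbcsKohnLuttingerB1g` (stmt-HubbardSuperconductivity-0158): the named third-order
# hypotheses of a WINDOW of `U₀` rows, and the kernel-decidable join of window rows to second-order record boxes

Companion of `Theorems/WeakCouplingBCSDefsKlThirdOrder.lean` (objects `K₃`, `thirdOrderForm`, the row-level named hypotheses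
`KLU0Row.ThirdOrderEnclosures`, the row/box consistency check `KLU0Row.dominates`) for the window records of
`Theorems/WeakCouplingBCSDefsKlU0Window(Record).lean` (`KLU0WinRow` = a `μ`-box with a `U₀` row valid uniformly on it):

* `klThirdOrderWindowJoin rows recs` (kernel-decidable): every window row's box is contained in a box of one of the second-order records
  `recs` with which the row is consistent (`dominates`) — for the rows of record, the 44 boxes ARE the boxes of `klCertB1gWin{A,B,C}`;
* `KlThirdOrderWindowEnclosures rows recs` — **the named third-order hypotheses of the window**: for every window row, every such matching
  record box and every `μ` of the row's box, the row's `ThirdOrderEnclosures μ Φ_B` for that box's `B1g` trial `Φ_B` (the cell's certified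
  computations are uniform in `μ` over each box: U0-TABLE.md v3 §4, two interval implementations).

The window selection theorem is `Theorems/WeakCouplingBCSKlThirdOrderSelectionWindow.lean`.  Nothing here asserts a pairing instability.
-/

noncomputable section

-- the tree's namespace `Summit.<Summit>.<Problem>.Theorems` repeats the summit name by design (D-0017)
set_option linter.dupNamespace false

namespace Summit.HubbardSuperconductivity.HubbardSuperconductivity.Theorems

open MeasureTheory Literature.MathematicalPhysics.QuantumLattice CwKLChiralWindow KlThirdOrder

/-- **Join of window rows to record boxes** (kernel-decidable): every row `w ∈ rows` has, in some record `c ∈ recs`, a box `bx` with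
`bx.mulo ≤ w.mulo`, `w.muhi ≤ bx.muhi` and `w.row.dominates bx c.trials`. [folklore] -/
def klThirdOrderWindowJoin (rows : List KLU0WinRow) (recs : List KLCert) : Bool :=
  rows.all fun w => recs.any fun c => c.boxes.any fun bx =>
    decide (bx.mulo ≤ w.mulo) && decide (w.muhi ≤ bx.muhi) && w.row.dominates bx c.trials

/-- **The named third-order hypotheses of a window of rows** against the second-order records `recs`: for every window row `w`, every
record `c ∈ recs` and every box `bx` of `c` that contains `w`'s box and with which `w.row` is consistent, and every level `μ` of `w`'s box:
`w.row.ThirdOrderEnclosures μ (bx.bB1g.trialFun c.trials)` (the `B1g`-side bound `⟨Φ_B, K₃ Φ_B⟩ ≤ (c3B + tB)‖Φ_B‖²` for the box's Ritz trial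
and the four competitor-side bounds `⟨ψ, K₃ ψ⟩ ≥ -(s3 + t)` on normalised channel states, at `μ`). [folklore] -/
def KlThirdOrderWindowEnclosures (rows : List KLU0WinRow) (recs : List KLCert) : Prop :=
  ∀ w ∈ rows, ∀ c ∈ recs, ∀ bx ∈ c.boxes, bx.mulo ≤ w.mulo → w.muhi ≤ bx.muhi → w.row.dominates bx c.trials = true →
    ∀ μ : ℝ, ((w.mulo : ℚ) : ℝ) ≤ μ → μ ≤ ((w.muhi : ℚ) : ℝ) →
      w.row.ThirdOrderEnclosures μ (bx.bB1g.trialFun c.trials)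

/-- Reading the join. [folklore] -/
theorem klThirdOrderWindowJoin_spec (rows : List KLU0WinRow) (recs : List KLCert)
    (h : klThirdOrderWindowJoin rows recs = true) :
    ∀ w ∈ rows, ∃ c ∈ recs, ∃ bx ∈ c.boxes,
      bx.mulo ≤ w.mulo ∧ w.muhi ≤ bx.muhi ∧ w.row.dominates bx c.trials = true := by
  intro w hw
  have h1 := List.all_eq_true.1 h w hw
  obtain ⟨c, hc, h2⟩ := List.any_eq_true.1 h1
  obtain ⟨bx, hbx, h3⟩ := List.any_eq_true.1 h2
  simp only [Bool.and_eq_true, decide_eq_true_eq] at h3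
  exact ⟨c, hc, bx, hbx, h3.1.1, h3.1.2, h3.2⟩

end Summit.HubbardSuperconductivity.HubbardSuperconductivity.Theorems

end
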